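import Summits.CriticalPhenomena.PercolationContinuityZ3.Theorems.PercNearOneGluingNoHeavyLowerTailCILRelayNeighboursHolds
import HarnessLib

/-!
# `NoHeavyLowerTail` (stmt-CriticalPhenomena-4575) — the STRONG cumulative isolation lemma for relay-neighboured observers

Support file (prover `prim-hp-2`, deletion–contraction / pivotal-edge line; `--supports stmt-CriticalPhenomena-4575`).
No definitions, no named facts, no sorries.  Setting of `Theorems.cil_relayNeighbours` (prover `prim-gen-induct`): observer `o ∉ A`
whose positive-weight neighbours are among the ports `p 0, …, p (d−1) ∈ A` (injective; ports of weight `0` allowed, so any relay may be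
listed), `H = G − o` read on `ω ∩ {e | o ∉ e}`, `M_l` = number of relays `H`-joined to `p l`.

* `cil_relayNeighbours_of_portComparison_strong` — under the port comparison (⋆) for `p i`:
  `μ{1 ≤ N ≤ j} ≤ μ({|π(p i)| ≤ j} ∩ {∃ l, o–p l open})` (the first-open-port proof never uses the witness's lightness on the event
  that every port edge is closed; proof = that proof verbatim with the last inclusion kept sharp);
* `cil_relayNeighbours_strong` — the same when `p i` dominates every port in `H` ((⋆) by `CutObserver.portComparison_of_separation`);
* `lightnessSlack_relayNeighbours` — `μ{all port edges closed}·μ{M_i ≤ j} + μ{1 ≤ N ≤ j} ≤ μ{|π(p i)| ≤ j}`: the CIL slack of an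
  `H`-dominating witness is at least the all-ports-closed mass times its `H`-lightness.  This is the (†)-input of prim-hp-2's proof of the
  two-sided core with a two-port star at levels `j ≤ 2` (crux notes TPS-P2EQ2.md §3–§4); numerically tight (0 / 613, inf = 0).
-/

noncomputable section

namespace Summit.CriticalPhenomena.PercolationContinuityZ3.Theorems

open MeasureTheory Set Literature.Probability.LatticeModels Literature.Probability.Percolation
open scoped Classical BigOperators

variable {n : ℕ}

open CutObserver in
/-- **Strong form of CIL with a witness adjacent to the observer.**  Setting and hypothesis (⋆) of
`Theorems.cil_relayNeighbours_of_portComparison`; conclusion `μ{1 ≤ N ≤ j} ≤ μ({|π(p i)| ≤ j} ∩ {some port edge is open})` — that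
proof verbatim with the last inclusion kept sharp. [cite: VandenbergHaggstromKahn2005, Thm. 1.5 (p. 7) — only through (⋆)] -/
theorem cil_relayNeighbours_of_portComparison_strong (w : Sym2 (Fin n) → unitInterval) (A : Finset (Fin n)) (o : Fin n)
    (j : ℕ) {d : ℕ} (p : Fin d → Fin n) (hp : Function.Injective p) (hpA : ∀ l, p l ∈ A) (hoA : o ∉ A)
    (hobs : ∀ v, w s(o, v) ≠ 0 → ∃ l, v = p l) (i : Fin d)
    (hstar : ∀ l, l ≠ i →
      (prodBernoulli w).real
          ({ω : BondConfig (Fin n) | ¬ (openGraph (ω ∩ {e | o ∉ e})).Reachable (p l) (p i)} ∩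
            {ω | ∀ m, l < m → (openGraph (ω ∩ {e | o ∉ e})).Reachable (p m) (p i) → s(o, p m) ∉ ω} ∩
            {ω | (A.filter fun x => (openGraph (ω ∩ {e | o ∉ e})).Reachable (p l) x).card ≤ j}) ≤
        (prodBernoulli w).real
          ({ω : BondConfig (Fin n) | ¬ (openGraph (ω ∩ {e | o ∉ e})).Reachable (p l) (p i)} ∩
            {ω | ∀ m, l < m → (openGraph (ω ∩ {e | o ∉ e})).Reachable (p m) (p i) → s(o, p m) ∉ ω} ∩
            {ω | (A.filter fun x => (openGraph (ω ∩ {e | o ∉ e})).Reachable (p i) x).card ≤ j})) :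
    (prodBernoulli w).real {ω : BondConfig (Fin n) |
        1 ≤ (A.filter fun x => ω ∈ openConn o x).card ∧ (A.filter fun x => ω ∈ openConn o x).card ≤ j} ≤
      (prodBernoulli w).real ({ω : BondConfig (Fin n) | (A.filter fun x => ω ∈ openConn (p i) x).card ≤ j} ∩
        {ω | ∃ l, s(o, p l) ∈ ω}) := by
  haveI : IsProbabilityMeasure (prodBernoulli w) := inferInstance
  -- notation
  set R : BondConfig (Fin n) → Fin n → Fin n → Prop := fun ω u v =>
    (openGraph (ω ∩ {e | o ∉ e})).Reachable u v with hR
  set M : BondConfig (Fin n) → Fin d → ℕ := fun ω l => (A.filter fun x => R ω (p l) x).card with hM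
  set bad := {ω : BondConfig (Fin n) |
    1 ≤ (A.filter fun x => ω ∈ openConn o x).card ∧ (A.filter fun x => ω ∈ openConn o x).card ≤ j} with hbad
  set T := {ω : BondConfig (Fin n) | (A.filter fun x => ω ∈ openConn (p i) x).card ≤ j} with hT
  set F : Fin d → Set (BondConfig (Fin n)) := fun l =>
    {ω | s(o, p l) ∈ ω ∧ ∀ m, m < l → s(o, p m) ∉ ω} with hF
  set Ξ : Fin d → Set (BondConfig (Fin n)) := fun l =>
    {ω | ¬ R ω (p l) (p i)} ∩ {ω | ∀ m, l < m → R ω (p m) (p i) → s(o, p m) ∉ ω} with hΞ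
  set V := {ω : BondConfig (Fin n) | (openGraph ω).Reachable (p i) o} with hV
  set G := {ω : BondConfig (Fin n) | ∀ e ∈ ω, w e ≠ 0} with hG
  have hpo : ∀ l, p l ≠ o := fun l h => hoA (h ▸ hpA l)
  -- (P4) an open port edge joins the port's H-cluster to o
  have hP4 : ∀ ω (l : Fin d) x, s(o, p l) ∈ ω → R ω (p l) x → (openGraph ω).Reachable o x := by
    intro ω l x hopen hR'
    have hadj : (openGraph ω).Adj o (p l) := by
      rw [openGraph, SimpleGraph.fromEdgeSet_adj]; exact ⟨hopen, (hpo l).symm⟩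
    exact hadj.reachable.trans (reachable_mono inter_subset_left hR')
  -- (P5) on G ∩ F l: p i ~ o ⇒ ¬ Ξ l
  have hP5 : ∀ ω (l : Fin d), ω ∈ G → ω ∈ F l → ω ∈ V → ω ∉ Ξ l := by
    intro ω l hωG hFl hVω hΞω
    obtain ⟨hopen, hclosed⟩ := hFl
    obtain ⟨hnot, hlater⟩ := hΞω
    have hreach : (openGraph ω).Reachable o (p i) := SimpleGraph.Reachable.symm hVω
    obtain ⟨wk⟩ := hreach
    set q := wk.bypass with hq
    have hpath : q.IsPath := wk.bypass_isPath
    cases hq' : q with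
    | nil => exact absurd rfl (hpo i)
    | cons hadj q' =>
      rename_i v
      rw [hq'] at hpath
      rw [SimpleGraph.Walk.cons_isPath_iff] at hpath
      rw [openGraph, SimpleGraph.fromEdgeSet_adj] at hadj
      obtain ⟨m, rfl⟩ := hobs v (hωG _ hadj.1)
      have hRmi : R ω (p m) (p i) := reachable_avoiding_of_walk q' hpath.2
      -- m ≥ l since the ports before l are closed
      rcases lt_trichotomy m l with hml | rfl | hlm
      · exact hclosed m hml hadj.1
      · exact hnot hRmi
      · exact hlater m hlm hRmi hadj.1
  -- (P3) off V, the cluster of p i is its H-cluster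
  have hP3 : ∀ ω, ω ∉ V → (A.filter fun x => ω ∈ openConn (p i) x).card = M ω i := by
    intro ω hVω
    rw [hM]
    congr 1
    refine Finset.filter_congr fun x _ => ⟨fun h => ?_, fun h => reachable_mono inter_subset_left h⟩
    exact reachable_avoiding_of_not_reachable hVω h
  -- (P1) the minority event lies in the union of the F l
  have hP1 : bad ∩ G ⊆ ⋃ l ∈ (Finset.univ : Finset (Fin d)), F l := by
    rintro ω ⟨⟨h1, _⟩, hωG⟩
    obtain ⟨x, hx⟩ := Finset.card_pos.1 (by omega : 0 < (A.filter fun x => ω ∈ openConn o x).card)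
    rw [Finset.mem_filter] at hx
    have hxo : x ≠ o := fun h => hoA (h ▸ hx.1)
    obtain ⟨wk⟩ := (hx.2 : (openGraph ω).Reachable o x)
    cases wk with
    | nil => exact absurd rfl hxo
    | @cons _ v _ hadj _ =>
      rw [openGraph, SimpleGraph.fromEdgeSet_adj] at hadj
      obtain ⟨m, rfl⟩ := hobs v (hωG _ hadj.1)
      set S := Finset.univ.filter fun m : Fin d => s(o, p m) ∈ ω with hS
      have hSne : S.Nonempty := ⟨m, Finset.mem_filter.2 ⟨Finset.mem_univ _, hadj.1⟩⟩
      refine mem_biUnion (Finset.mem_univ (S.min' hSne)) ⟨(Finset.mem_filter.1 (Finset.min'_mem S hSne)).2, ?_⟩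
      intro m' hm' hopen'
      have : S.min' hSne ≤ m' := Finset.min'_le S m' (Finset.mem_filter.2 ⟨Finset.mem_univ _, hopen'⟩)
      exact absurd hm' (not_lt.2 this)
  -- supports: port edges up to l vs. H-edges and later port edges
  set Eo : Finset (Sym2 (Fin n)) := Finset.univ.filter fun e : Sym2 (Fin n) => o ∉ e with hEo
  have hcoe : (↑Eo : Set (Sym2 (Fin n))) = {e | o ∉ e} := coe_edgesAvoiding o
  set Early : Fin d → Finset (Sym2 (Fin n)) := fun l =>
    (Finset.univ.filter fun m : Fin d => m ≤ l).image fun m => s(o, p m) with hEarly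
  set Late : Fin d → Finset (Sym2 (Fin n)) := fun l =>
    Eo ∪ (Finset.univ.filter fun m : Fin d => l < m).image fun m => s(o, p m) with hLate
  have hdisjEL : ∀ l, Disjoint (Early l) (Late l) := by
    intro l
    rw [Finset.disjoint_left]
    intro e he he'
    rw [hEarly, Finset.mem_image] at he
    obtain ⟨m, hm, rfl⟩ := he
    rw [Finset.mem_filter] at hm
    rw [hLate, Finset.mem_union] at he'
    rcases he' with h | h
    · rw [hEo, Finset.mem_filter] at h
      exact h.2 (Sym2.mem_mk_left _ _)
    · rw [Finset.mem_image] at h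
      obtain ⟨m', hm', heq⟩ := h
      rw [Finset.mem_filter] at hm'
      have : m' = m := hp (Sym2.congr_right.1 heq)
      subst this
      exact absurd (lt_of_lt_of_le hm'.2 hm.2) (lt_irrefl _)
  have hF_det : ∀ l, DeterminedBy (F l) (↑(Early l) : Set (Sym2 (Fin n))) := by
    intro l
    rw [determinedBy_iff]
    intro ω ω' h
    have key : ∀ m, m ≤ l → (s(o, p m) ∈ ω ↔ s(o, p m) ∈ ω') := by
      intro m hm
      have hmem : s(o, p m) ∈ (↑(Early l) : Set (Sym2 (Fin n))) := by
        rw [Finset.mem_coe, hEarly, Finset.mem_image]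
        exact ⟨m, Finset.mem_filter.2 ⟨Finset.mem_univ _, hm⟩, rfl⟩
      have := Set.ext_iff.1 h (s(o, p m))
      simp only [mem_inter_iff, hmem, and_true] at this
      exact this
    simp only [hF, mem_setOf_eq]
    rw [key l le_rfl]
    constructor
    · rintro ⟨h1, h2⟩; exact ⟨h1, fun m hm => (key m hm.le).not.1 (h2 m hm)⟩
    · rintro ⟨h1, h2⟩; exact ⟨h1, fun m hm => (key m hm.le).not.2 (h2 m hm)⟩
  have hH_det : ∀ (l : Fin d) (x : Fin d), DeterminedBy (Ξ l ∩ {ω | M ω x ≤ j})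
      (↑(Late l) : Set (Sym2 (Fin n))) := by
    intro l x
    rw [determinedBy_iff]
    intro ω ω' h
    have hH : ω ∩ {e | o ∉ e} = ω' ∩ {e | o ∉ e} := by
      rw [← hcoe]
      ext f
      have := Set.ext_iff.1 h f
      simp only [hLate, Finset.coe_union, mem_inter_iff, mem_union, Finset.mem_coe] at this ⊢
      constructor
      · rintro ⟨hf, hfE⟩; exact ⟨(this.1 ⟨hf, Or.inl hfE⟩).1, hfE⟩
      · rintro ⟨hf, hfE⟩; exact ⟨(this.2 ⟨hf, Or.inl hfE⟩).1, hfE⟩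
    have hlate : ∀ m, l < m → (s(o, p m) ∈ ω ↔ s(o, p m) ∈ ω') := by
      intro m hm
      have hmem : s(o, p m) ∈ (↑(Late l) : Set (Sym2 (Fin n))) := by
        rw [Finset.mem_coe, hLate, Finset.mem_union, Finset.mem_image]
        exact Or.inr ⟨m, Finset.mem_filter.2 ⟨Finset.mem_univ _, hm⟩, rfl⟩
      have := Set.ext_iff.1 h (s(o, p m))
      simp only [mem_inter_iff, hmem, and_true] at this
      exact this
    simp only [hΞ, hM, hR, mem_inter_iff, mem_setOf_eq]
    rw [hH]
    constructor
    · rintro ⟨⟨h1, h2⟩, h3⟩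
      exact ⟨⟨h1, fun m hm hr => (hlate m hm).not.1 (h2 m hm hr)⟩, h3⟩
    · rintro ⟨⟨h1, h2⟩, h3⟩
      exact ⟨⟨h1, fun m hm hr => (hlate m hm).not.2 (h2 m hm hr)⟩, h3⟩
  have hfactor : ∀ (l x : Fin d), (prodBernoulli w).real (F l ∩ (Ξ l ∩ {ω | M ω x ≤ j})) =
      (prodBernoulli w).real (F l) * (prodBernoulli w).real (Ξ l ∩ {ω | M ω x ≤ j}) :=
    fun l x => prodBernoulli_real_inter_of_determinedBy_disjoint w (hdisjEL l) (hF_det l) (hH_det l x)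
      MeasurableSet.of_discrete MeasurableSet.of_discrete
  -- per-port comparison
  have hper : ∀ l, (prodBernoulli w).real (F l ∩ bad ∩ G) ≤ (prodBernoulli w).real (F l ∩ T) := by
    intro l
    have hsplit : F l ∩ bad ∩ G ⊆ (F l ∩ T ∩ V) ∪ (F l ∩ (Ξ l ∩ {ω | M ω l ≤ j})) := by
      rintro ω ⟨⟨hFl, hb⟩, hωG⟩
      by_cases hVω : ω ∈ V
      · refine Or.inl ⟨⟨hFl, ?_⟩, hVω⟩
        show (A.filter fun x => ω ∈ openConn (p i) x).card ≤ j
        have heq : (A.filter fun x => ω ∈ openConn (p i) x) = (A.filter fun x => ω ∈ openConn o x) :=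
          Finset.filter_congr fun x _ =>
            ⟨fun h => (SimpleGraph.Reachable.symm hVω).trans h, fun h => hVω.trans h⟩
        rw [heq]; exact hb.2
      · -- Ξ l holds (contrapositive of P5 needs the converse: ¬V ⇒ Ξ l)
        have hΞω : ω ∈ Ξ l := by
          refine ⟨fun hr => hVω ?_, fun m hm hr hopen => hVω ?_⟩
          · exact ((hP4 ω l (p i) hFl.1 hr)).symm
          · exact ((hP4 ω m (p i) hopen hr)).symm
        refine Or.inr ⟨hFl, hΞω, ?_⟩
        show M ω l ≤ j
        refine le_trans (Finset.card_le_card fun x hx => ?_) hb.2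
        rw [Finset.mem_filter] at hx ⊢
        exact ⟨hx.1, hP4 ω l x hFl.1 hx.2⟩
    have hback : F l ∩ (Ξ l ∩ {ω | M ω i ≤ j}) ∩ G ⊆ (F l ∩ T) \ V := by
      rintro ω ⟨⟨hFl, hΞω, hMi⟩, hωG⟩
      have hVω : ω ∉ V := fun hVω => hP5 ω l hωG hFl hVω hΞω
      refine ⟨⟨hFl, ?_⟩, hVω⟩
      show (A.filter fun x => ω ∈ openConn (p i) x).card ≤ j
      rw [hP3 ω hVω]; exact hMi
    by_cases hli : l = i
    · -- F i ⊆ V: the first summand suffices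
      subst hli
      refine measureReal_mono (fun ω hω => ?_) (measure_ne_top _ _)
      obtain ⟨⟨hFl, hb⟩, _⟩ := hω
      have hVω : ω ∈ V := by
        have hadj : (openGraph ω).Adj (p l) o := by
          rw [openGraph, SimpleGraph.fromEdgeSet_adj, Sym2.eq_swap]; exact ⟨hFl.1, hpo l⟩
        exact hadj.reachable
      refine ⟨hFl, ?_⟩
      show (A.filter fun x => ω ∈ openConn (p l) x).card ≤ j
      have heq : (A.filter fun x => ω ∈ openConn (p l) x) = (A.filter fun x => ω ∈ openConn o x) :=
        Finset.filter_congr fun x _ =>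
          ⟨fun h => (SimpleGraph.Reachable.symm hVω).trans h, fun h => hVω.trans h⟩
      rw [heq]; exact hb.2
    calc (prodBernoulli w).real (F l ∩ bad ∩ G)
        ≤ (prodBernoulli w).real ((F l ∩ T ∩ V) ∪ (F l ∩ (Ξ l ∩ {ω | M ω l ≤ j}))) :=
          measureReal_mono hsplit (measure_ne_top _ _)
      _ ≤ (prodBernoulli w).real (F l ∩ T ∩ V) + (prodBernoulli w).real (F l ∩ (Ξ l ∩ {ω | M ω l ≤ j})) :=
          measureReal_union_le _ _
      _ = (prodBernoulli w).real (F l ∩ T ∩ V) +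
            (prodBernoulli w).real (F l) * (prodBernoulli w).real (Ξ l ∩ {ω | M ω l ≤ j}) := by rw [hfactor]
      _ ≤ (prodBernoulli w).real (F l ∩ T ∩ V) +
            (prodBernoulli w).real (F l) * (prodBernoulli w).real (Ξ l ∩ {ω | M ω i ≤ j}) := by
          have := mul_le_mul_of_nonneg_left (hstar l hli) (measureReal_nonneg (μ := prodBernoulli w) (s := F l))
          linarith
      _ = (prodBernoulli w).real (F l ∩ T ∩ V) + (prodBernoulli w).real (F l ∩ (Ξ l ∩ {ω | M ω i ≤ j})) := by
          rw [hfactor]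
      _ = (prodBernoulli w).real (F l ∩ T ∩ V) +
            (prodBernoulli w).real (F l ∩ (Ξ l ∩ {ω | M ω i ≤ j}) ∩ G) := by rw [measureReal_inter_support]
      _ ≤ (prodBernoulli w).real (F l ∩ T ∩ V) + (prodBernoulli w).real ((F l ∩ T) \ V) := by
          have := measureReal_mono (μ := prodBernoulli w) hback (measure_ne_top _ _)
          linarith
      _ = (prodBernoulli w).real (F l ∩ T) :=
          measureReal_inter_add_sdiff (MeasurableSet.of_discrete (s := V)) (measure_ne_top _ _)
  -- the F l are pairwise disjoint
  have hFdisj : (↑(Finset.univ : Finset (Fin d)) : Set (Fin d)).PairwiseDisjoint fun l => F l ∩ T := by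
    intro l _ l' _ hll'
    rw [Function.onFun, Set.disjoint_left]
    rintro ω ⟨⟨hopen, hclosed⟩, _⟩ ⟨⟨hopen', hclosed'⟩, _⟩
    rcases lt_or_gt_of_ne hll' with h | h
    · exact hclosed' l h hopen
    · exact hclosed l' h hopen'
  -- assemble
  calc (prodBernoulli w).real bad
      = (prodBernoulli w).real (bad ∩ G) := (measureReal_inter_support w bad).symm
    _ ≤ (prodBernoulli w).real (⋃ l ∈ (Finset.univ : Finset (Fin d)), F l ∩ bad ∩ G) := by
        refine measureReal_mono (fun ω hω => ?_) (measure_ne_top _ _)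
        have := hP1 hω
        rw [mem_iUnion₂] at this ⊢
        obtain ⟨l, hl, hFl⟩ := this
        exact ⟨l, hl, ⟨hFl, hω.1⟩, hω.2⟩
    _ ≤ ∑ l ∈ (Finset.univ : Finset (Fin d)), (prodBernoulli w).real (F l ∩ bad ∩ G) :=
        measureReal_biUnion_finset_le _ _
    _ ≤ ∑ l ∈ (Finset.univ : Finset (Fin d)), (prodBernoulli w).real (F l ∩ T) :=
        Finset.sum_le_sum fun l _ => hper l
    _ = (prodBernoulli w).real (⋃ l ∈ (Finset.univ : Finset (Fin d)), F l ∩ T) :=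
        (measureReal_biUnion_finset hFdisj fun l _ => MeasurableSet.of_discrete).symm
    _ ≤ (prodBernoulli w).real (T ∩ {ω | ∃ l, s(o, p l) ∈ ω}) :=
        measureReal_mono (iUnion₂_subset fun l _ => fun ω hω => ⟨hω.2, l, hω.1.1⟩) (measure_ne_top _ _)


open CutObserver in
/-- **Strong CIL for a relay-neighboured observer with an `H`-dominating port** (`μ{M_l ≤ j} ≤ μ{M_i ≤ j}` for all ports):
`μ{1 ≤ N ≤ j} ≤ μ({|π(p i)| ≤ j} ∩ {some port edge open})`; a relay not adjacent to `o` may be listed as a port of weight `0`.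
[cite: VandenbergHaggstromKahn2005, Thm. 1.5 (p. 7) — via `CutObserver.portComparison_of_separation`] -/
theorem cil_relayNeighbours_strong (w : Sym2 (Fin n) → unitInterval) (A : Finset (Fin n)) (o : Fin n) (j : ℕ) {d : ℕ}
    (p : Fin d → Fin n) (hp : Function.Injective p) (hpA : ∀ l, p l ∈ A) (hoA : o ∉ A)
    (hobs : ∀ v, w s(o, v) ≠ 0 → ∃ l, v = p l) (i : Fin d)
    (hdom : ∀ l : Fin d,
      (prodBernoulli w).real {ω : BondConfig (Fin n) |
          (A.filter fun x => (openGraph (ω ∩ {e | o ∉ e})).Reachable (p l) x).card ≤ j} ≤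
        (prodBernoulli w).real {ω : BondConfig (Fin n) |
          (A.filter fun x => (openGraph (ω ∩ {e | o ∉ e})).Reachable (p i) x).card ≤ j}) :
    (prodBernoulli w).real {ω : BondConfig (Fin n) |
        1 ≤ (A.filter fun x => ω ∈ openConn o x).card ∧ (A.filter fun x => ω ∈ openConn o x).card ≤ j} ≤
      (prodBernoulli w).real ({ω : BondConfig (Fin n) | (A.filter fun x => ω ∈ openConn (p i) x).card ≤ j} ∩
        {ω | ∃ l, s(o, p l) ∈ ω}) := by
  refine cil_relayNeighbours_of_portComparison_strong w A o j p hp hpA hoA hobs i ?_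
  intro l hli
  have key := portComparison_of_separation w A o j p hp (Ne.symm hli) (hdom l)
    (Finset.univ.filter fun m => l < m) {p l}
  have e : ∀ x : Fin d,
      {ω : BondConfig (Fin n) | ¬ (openGraph (ω ∩ {e | o ∉ e})).Reachable (p l) (p i)} ∩
        {ω | ∀ m, l < m → (openGraph (ω ∩ {e | o ∉ e})).Reachable (p m) (p i) → s(o, p m) ∉ ω} ∩
        {ω | (A.filter fun y => (openGraph (ω ∩ {e | o ∉ e})).Reachable (p x) y).card ≤ j} =
      {ω : BondConfig (Fin n) | ∀ m ∈ (Finset.univ.filter fun m => l < m),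
          (openGraph (ω ∩ {e | o ∉ e})).Reachable (p m) (p i) → s(o, p m) ∉ ω} ∩
        {ω | ∀ v ∈ ({p l} : Finset (Fin n)), ¬ (openGraph (ω ∩ {e | o ∉ e})).Reachable v (p i)} ∩
        {ω | (A.filter fun y => (openGraph (ω ∩ {e | o ∉ e})).Reachable (p x) y).card ≤ j} := by
    intro x
    ext ω
    simp only [Finset.mem_filter, Finset.mem_univ, true_and, Finset.mem_singleton, forall_eq, mem_inter_iff,
      mem_setOf_eq]
    tauto
  rw [e l, e i]; exact key

open CutObserver in
/-- **The lightness slack of an `H`-dominating port.**  In the setting of `cil_relayNeighbours_strong`: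
`μ{every port edge closed}·μ{M_i ≤ j} + μ{1 ≤ N ≤ j} ≤ μ{|π(p i)| ≤ j}` (on the all-closed event the cluster of `p i` is its
`H`-cluster, and that event is independent of `H`). [cite: VandenbergHaggstromKahn2005, Thm. 1.5 (p. 7) — via `cil_relayNeighbours_strong`] -/
theorem lightnessSlack_relayNeighbours (w : Sym2 (Fin n) → unitInterval) (A : Finset (Fin n)) (o : Fin n) (j : ℕ) {d : ℕ}
    (p : Fin d → Fin n) (hp : Function.Injective p) (hpA : ∀ l, p l ∈ A) (hoA : o ∉ A)
    (hobs : ∀ v, w s(o, v) ≠ 0 → ∃ l, v = p l) (i : Fin d)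
    (hdom : ∀ l : Fin d,
      (prodBernoulli w).real {ω : BondConfig (Fin n) |
          (A.filter fun x => (openGraph (ω ∩ {e | o ∉ e})).Reachable (p l) x).card ≤ j} ≤
        (prodBernoulli w).real {ω : BondConfig (Fin n) |
          (A.filter fun x => (openGraph (ω ∩ {e | o ∉ e})).Reachable (p i) x).card ≤ j}) :
    (prodBernoulli w).real {ω : BondConfig (Fin n) | ∀ l, s(o, p l) ∉ ω} *
        (prodBernoulli w).real {ω : BondConfig (Fin n) |
          (A.filter fun x => (openGraph (ω ∩ {e | o ∉ e})).Reachable (p i) x).card ≤ j} +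
      (prodBernoulli w).real {ω : BondConfig (Fin n) |
        1 ≤ (A.filter fun x => ω ∈ openConn o x).card ∧ (A.filter fun x => ω ∈ openConn o x).card ≤ j} ≤
      (prodBernoulli w).real {ω : BondConfig (Fin n) | (A.filter fun x => ω ∈ openConn (p i) x).card ≤ j} := by
  set μ := prodBernoulli w with hμ
  set T := {ω : BondConfig (Fin n) | (A.filter fun x => ω ∈ openConn (p i) x).card ≤ j} with hT
  set O := {ω : BondConfig (Fin n) | ∃ l, s(o, p l) ∈ ω} with hO
  set C := {ω : BondConfig (Fin n) | ∀ l, s(o, p l) ∉ ω} with hC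
  set TH := {ω : BondConfig (Fin n) | (A.filter fun x => (openGraph (ω ∩ {e | o ∉ e})).Reachable (p i) x).card ≤ j} with hTH
  set G := {ω : BondConfig (Fin n) | ∀ e ∈ ω, w e ≠ 0} with hG
  have hstrong := cil_relayNeighbours_strong w A o j p hp hpA hoA hobs i hdom
  have hOc : ∀ ω, ω ∉ O ↔ ω ∈ C := fun ω => by simp only [hO, hC, mem_setOf_eq, not_exists]
  have hsplit : μ.real T = μ.real (T ∩ O) + μ.real (T \ O) :=
    (measureReal_inter_add_sdiff (MeasurableSet.of_discrete (s := O)) (measure_ne_top _ _)).symm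
  -- on C ∩ G the cluster of p i is its H-cluster (an open edge at o would be a port edge or a weight-0 pair)
  have hclus : ∀ ω, ω ∈ C → ω ∈ G → (A.filter fun x => ω ∈ openConn (p i) x) =
      (A.filter fun x => (openGraph (ω ∩ {e | o ∉ e})).Reachable (p i) x) := by
    intro ω hC' hG'
    refine Finset.filter_congr fun x _ => ⟨fun h => ?_, fun h => reachable_mono inter_subset_left h⟩
    refine reachable_avoiding_of_not_reachable (fun hio => ?_) h
    obtain ⟨wk⟩ := hio.symm
    cases wk with
    | nil => exact hoA (hpA i)
    | @cons _ v _ hadj _ =>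
      rw [openGraph, SimpleGraph.fromEdgeSet_adj] at hadj
      obtain ⟨m, rfl⟩ := hobs v (hG' _ hadj.1)
      exact hC' m hadj.1
  have hTC : (T \ O) ∩ G = (C ∩ TH) ∩ G := by
    ext ω
    simp only [mem_inter_iff, mem_sdiff]
    constructor
    · rintro ⟨⟨hT', hO'⟩, hG'⟩
      have hC' : ω ∈ C := (hOc ω).1 hO'
      refine ⟨⟨hC', ?_⟩, hG'⟩
      show (A.filter fun x => (openGraph (ω ∩ {e | o ∉ e})).Reachable (p i) x).card ≤ j
      rw [← hclus ω hC' hG']; exact hT'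
    · rintro ⟨⟨hC', hTH'⟩, hG'⟩
      refine ⟨⟨?_, (hOc ω).2 hC'⟩, hG'⟩
      show (A.filter fun x => ω ∈ openConn (p i) x).card ≤ j
      rw [hclus ω hC' hG']; exact hTH'
  -- independence of C (port edges) and TH (edges off o)
  set Ports : Finset (Sym2 (Fin n)) := Finset.univ.image fun l : Fin d => s(o, p l) with hPorts
  set Eo : Finset (Sym2 (Fin n)) := Finset.univ.filter fun e : Sym2 (Fin n) => o ∉ e with hEo
  have hdisj : Disjoint Ports Eo := by
    rw [Finset.disjoint_left]; intro e he he'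
    rw [hPorts, Finset.mem_image] at he; obtain ⟨l, -, rfl⟩ := he
    rw [hEo, Finset.mem_filter] at he'; exact he'.2 (Sym2.mem_mk_left _ _)
  have hC_det : DeterminedBy C (↑Ports : Set (Sym2 (Fin n))) := by
    rw [determinedBy_iff]
    intro ω ω' h
    simp only [hC, mem_setOf_eq]
    refine forall_congr' fun l => ?_
    have hmem : s(o, p l) ∈ (↑Ports : Set (Sym2 (Fin n))) := by rw [Finset.mem_coe, hPorts, Finset.mem_image]; exact ⟨l, by simp, rfl⟩
    have := Set.ext_iff.1 h (s(o, p l))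
    simp only [mem_inter_iff, hmem, and_true] at this
    rw [this]
  have hTH_det : DeterminedBy TH (↑Eo : Set (Sym2 (Fin n))) := by
    have h := determinedBy_restrict Eo (fun ξ => (A.filter fun x => (openGraph ξ).Reachable (p i) x).card ≤ j)
    rw [coe_edgesAvoiding] at h
    rw [hEo, coe_edgesAvoiding]; exact h
  have hind : μ.real (C ∩ TH) = μ.real C * μ.real TH :=
    prodBernoulli_real_inter_of_determinedBy_disjoint w hdisj hC_det hTH_det MeasurableSet.of_discrete MeasurableSet.of_discrete
  have h1 : μ.real (T \ O) = μ.real C * μ.real TH := by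
    rw [← measureReal_inter_support w (T \ O), hTC, measureReal_inter_support, hind]
  rw [hsplit, h1]; linarith [hstrong]

end Summit.CriticalPhenomena.PercolationContinuityZ3.Theorems

end
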